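import Summits.Ventures.LatticeQCDFlow.Exactness.IMHColdStartMSELimit
import Summits.Ventures.LatticeQCDFlow.Exactness.IMHColdStartDiscard
import HarnessLib

/-!
# The cold start, second order: discarding `b` steps multiplies the whole second-order correction of the
# cold-started mean-square error by exactly `r^b`

HONEST FRAMING: exact (Metropolis-corrected) sampling algorithms for lattice gauge theory;
figures of merit are autocorrelation/cost numbers at stated couplings and volumes; no
continuum-physics claim.

Venture `LatticeQCDFlow` (cell pub-lqcd), topic `Exactness`; FANOUT row 30 (lean-1, GEN-32).  NEW WORK of the
cell, general state space.  Setting of `IMHColdStartMSE` / `IMHColdStartMSELimit` (this generation): `K = indepMH q w`,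
`w` normalised, maximal at `x₀`, `w = w(x₀)`, `r = 1 − 1/w`, `f` bounded measurable, `f̄ = f − π f`,
`δ = f(x₀) − π f`, `γ_u` the stationary autocovariances, `V = γ_0`, `σ²_f = γ_0 + 2Σ_{u≥1}γ_u`,
`P_N = Σ_{k<N}(2k+1)r^k`, `Q_N = Σ_{i,j<N} r^{min(i,j)}γ_{|i−j|}`.  GEN-31 (`IMHColdStartDiscard`) priced the WINDOW
`[b, b+N)` of a cold-started run at first order (its bias is `r^b·δ·S_N/N`); `IMHColdStartMSE` priced the full run at
second order (`N²(MSE_{x₀}(N) − MSE_π(N)) = δ²P_N − Q_N`).  Here the window at second order: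

* §1 **`chain_sqError_windowAverage_eq`** — for any Markov kernel and start, the squared error of the window average
  `A_{b,N} = (1/N)Σ_{i<N} f(X_{b+i})` about a constant is the double sum of its two-time moments (bookkeeping, as the
  Scoring row's `chain_sqError_timeAverage_eq`).
* §2 **`imh_chain_window_pair_mode`** — `E_{x₀}[f̄(X_{b+i})f̄(X_{b+j})] = (1 − r^{b+min(i,j)})γ_{|i−j|} + r^{b+max(i,j)}δ²`.
* §3 **`imh_chain_windowMSE_mode_sub_stationary`** — THE EXACT WINDOW LAW:
  `N²·(E_{x₀}[(A_{b,N} − π f)²] − MSE_π(N)) = r^b·(δ²·P_N − Q_N)` — DISCARDING `b` STEPS MULTIPLIES THE ENTIRE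
  SECOND-ORDER COLD-START CORRECTION (bias² and the variance defect alike) BY EXACTLY `r^b = (1 − A(x₀))^b`.
* §4 **`imh_chain_windowMSE_mode_two_sided`** — `r^b(δ² − V)P_N ≤ N²(… − MSE_π(N)) ≤ r^b δ² P_N`; hence
  **`imh_chain_windowMSE_mode_le`** — `E_{x₀}[(A_{b,N} − π f)²] ≤ MSE_π(N) + r^b(2w² − w)δ²/N²`, and
  **`imh_chain_windowMSE_mode_le_of_log_le`** — `log(1/ε) ≤ b/w` ⇒ `≤ MSE_π(N) + ε·(2w² − w)δ²/N²`: a discard of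
  `w·log(1/ε) = log(1/ε)/A(x₀)` steps leaves an `ε`-fraction of the cold start's second-order price.
* §5 **`imh_chain_windowMSE_mode_limit`** — `N²·(E_{x₀}[(A_{b,N} − π f)²] − MSE_π(N)) → r^b·((2w² − w)δ² − w·σ²_f)`.

Reading (value-free): for the exact gauge samplers (`r = 1 − A`, `A = Z/(c^{#B}M^k)` resp. `Z/∏_ℓ c_{#C_ℓ}`) the
recipe "discard `log(1/ε)/A` steps, then average" makes the cold-started run's mean-square error equal to the
equilibrium run's up to `ε·(2/A² − 1/A)·max(δf², Var_π f)/N²`.  NOT CLAIMED: an optimal `b` for fixed total cost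
`b + N` (depends on `σ²_f`, not controlled here); non-modal starts.

No `sorry`, no new definitions, nothing cited as a fact; general measurable space with measurable singletons.
-/

noncomputable section

namespace Summit.Ventures.LatticeQCDFlow.Exactness

open MeasureTheory ProbabilityTheory Function Finset Filter Topology
open scoped ENNReal
open Summit.Ventures.LatticeQCDFlow.Scoring

variable {Ω : Type*} [MeasurableSpace Ω] [MeasurableSingletonClass Ω]
variable {q : Measure Ω} [IsProbabilityMeasure q] {w : Ω → ℝ}

/-! ## §1 The squared error of a window average is a double sum of two-time moments -/

omit [MeasurableSingletonClass Ω] [IsProbabilityMeasure q] in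
/-- **Window version of the Scoring row's `chain_sqError_timeAverage_eq`**: for every Markov kernel, start, bounded
measurable `f`, constant `m`, offset `b` and `N ≥ 1`,
`E[((1/N)Σ_{i<N} f(X_{b+i}) − m)²] = (1/N²)Σ_{i,j<N} E[(f(X_{b+i}) − m)(f(X_{b+j}) − m)]`. [ours, bookkeeping] -/
theorem chain_sqError_windowAverage_eq (κ : Kernel Ω Ω) [IsMarkovKernel κ] (μ₀ : Measure Ω)
    [IsProbabilityMeasure μ₀] {f : Ω → ℝ} (hf : Measurable f) {C : ℝ} (hC : ∀ x, |f x| ≤ C) (m : ℝ) (b : ℕ)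
    {N : ℕ} (hN : N ≠ 0) :
    ∫ x, ((∑ i ∈ Finset.range N, f (x (b + i))) / N - m) ^ 2 ∂(Kernel.trajMeasure (X := fun _ : ℕ => Ω) μ₀
        (fun n : ℕ => κ.comap (fun h : (i : ↥(Finset.Iic n)) → Ω => h ⟨n, Finset.mem_Iic.2 le_rfl⟩)
          (measurable_pi_apply _)))
      = (∑ i ∈ Finset.range N, ∑ j ∈ Finset.range N,
          ∫ x, (f (x (b + i)) - m) * (f (x (b + j)) - m) ∂(Kernel.trajMeasure (X := fun _ : ℕ => Ω) μ₀
            (fun n : ℕ => κ.comap (fun h : (i : ↥(Finset.Iic n)) → Ω => h ⟨n, Finset.mem_Iic.2 le_rfl⟩)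
              (measurable_pi_apply _)))) / (N : ℝ) ^ 2 := by
  set P := Kernel.trajMeasure (X := fun _ : ℕ => Ω) μ₀
      (fun n : ℕ => κ.comap (fun h : (i : ↥(Finset.Iic n)) → Ω => h ⟨n, Finset.mem_Iic.2 le_rfl⟩)
        (measurable_pi_apply _)) with hP
  have hN' : (N : ℝ) ≠ 0 := by exact_mod_cast hN
  have hgb : ∀ y, |f y - m| ≤ C + |m| := fun y => (abs_sub _ _).trans (add_le_add (hC y) le_rfl)
  have hint : ∀ i j, Integrable (fun x : ℕ → Ω => (f (x (b + i)) - m) * (f (x (b + j)) - m)) P := fun i j =>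
    integrable_of_bounded P
      (((hf.comp (measurable_pi_apply (b + i))).sub measurable_const).mul
        ((hf.comp (measurable_pi_apply (b + j))).sub measurable_const)) (C := (C + |m|) * (C + |m|))
      fun x => by
        rw [abs_mul]
        exact mul_le_mul (hgb _) (hgb _) (abs_nonneg _) ((abs_nonneg _).trans (hgb (x (b + i))))
  have hpt : ∀ x : ℕ → Ω, ((∑ i ∈ Finset.range N, f (x (b + i))) / N - m) ^ 2
      = (∑ i ∈ Finset.range N, ∑ j ∈ Finset.range N, (f (x (b + i)) - m) * (f (x (b + j)) - m)) /
          (N : ℝ) ^ 2 := by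
    intro x
    have h1 : (∑ i ∈ Finset.range N, f (x (b + i))) / N - m = (∑ i ∈ Finset.range N, (f (x (b + i)) - m)) / N := by
      rw [Finset.sum_sub_distrib, Finset.sum_const, Finset.card_range, nsmul_eq_mul]
      field_simp
    rw [h1, div_pow, sq (∑ i ∈ Finset.range N, (f (x (b + i)) - m)), Finset.sum_mul_sum]
  rw [integral_congr_ae (ae_of_all _ hpt), integral_div, integral_finsetSum _ fun i _ =>
    integrable_finsetSum _ fun j _ => hint i j]
  congr 1
  exact Finset.sum_congr rfl fun i _ => integral_finsetSum _ fun j _ => hint i j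

/-! ## §2 Window pair moments from the mode -/

/-- **`E_{x₀}[f̄(X_{b+i}) f̄(X_{b+j})] = (1 − r^{b+min(i,j)})·γ_{|i−j|} + r^{b+max(i,j)}·δ²`.** [ours] -/
theorem imh_chain_window_pair_mode [Fact (Measurable w)] (hw0 : ∀ y, 0 < w y) {x₀ : Ω}
    (hmax : ∀ y, w y ≤ w x₀) [IsProbabilityMeasure (q.withDensity fun y => ENNReal.ofReal (w y))]
    {f : Ω → ℝ} (hf : Measurable f) {C : ℝ} (hC : ∀ x, |f x| ≤ C) (b i j : ℕ) :
    ∫ x, (f (x (b + i)) - ∫ z, f z ∂(q.withDensity fun y => ENNReal.ofReal (w y))) *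
        (f (x (b + j)) - ∫ z, f z ∂(q.withDensity fun y => ENNReal.ofReal (w y)))
        ∂(Kernel.trajMeasure (X := fun _ : ℕ => Ω) (Measure.dirac x₀)
          (fun n : ℕ => (indepMH q w).comap (fun h : (i : ↥(Finset.Iic n)) → Ω => h ⟨n, Finset.mem_Iic.2 le_rfl⟩)
            (measurable_pi_apply _))) =
      (1 - (1 - (w x₀)⁻¹) ^ (b + min i j)) *
          autocov (indepMH q w) (q.withDensity fun y => ENNReal.ofReal (w y))
            (fun x => f x - ∫ z, f z ∂(q.withDensity fun y => ENNReal.ofReal (w y))) (Nat.dist i j) +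
        (1 - (w x₀)⁻¹) ^ (b + max i j) *
          (f x₀ - ∫ z, f z ∂(q.withDensity fun y => ENNReal.ofReal (w y))) ^ 2 := by
  rw [imh_chain_pair_mode hw0 hmax hf hC (b + i) (b + j), min_add_add_left, max_add_add_left,
    Nat.dist_add_add_left]

/-! ## §3 The exact window law -/

omit [MeasurableSingletonClass Ω] [IsProbabilityMeasure q] in
/-- Splitting the window double sum: `Σ_{i,j} [(1 − r^{b+min})γ + r^{b+max}δ²] = Σ_{i,j} γ − r^b·Σ_{i,j} r^{min}γ +
r^b·δ²·P_N`. [ours, bookkeeping] -/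
theorem sum_sum_window_split (r δ : ℝ) (γ : ℕ → ℝ) (b N : ℕ) :
    ∑ i ∈ Finset.range N, ∑ j ∈ Finset.range N,
        ((1 - r ^ (b + min i j)) * γ (Nat.dist i j) + r ^ (b + max i j) * δ ^ 2) =
      ∑ i ∈ Finset.range N, ∑ j ∈ Finset.range N, γ (Nat.dist i j) -
        r ^ b * ∑ i ∈ Finset.range N, ∑ j ∈ Finset.range N, r ^ min i j * γ (Nat.dist i j) +
          r ^ b * (δ ^ 2 * ∑ k ∈ Finset.range N, (2 * (k : ℝ) + 1) * r ^ k) := by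
  rw [← sum_sum_max (fun k => r ^ k) N, mul_sum, mul_sum, mul_sum, ← sum_sub_distrib, ← sum_add_distrib]
  refine sum_congr rfl fun i _ => ?_
  rw [mul_sum, mul_sum, mul_sum, ← sum_sub_distrib, ← sum_add_distrib]
  refine sum_congr rfl fun j _ => ?_
  rw [pow_add, pow_add]
  ring

/-- **THE EXACT WINDOW LAW**: for `N ≥ 1` and every offset `b`,
`N²·(E_{x₀}[(A_{b,N} − π f)²] − MSE_π(N)) = r^b·(δ²·P_N − Σ_{i,j<N} r^{min(i,j)}γ_{|i−j|})` — discarding `b` steps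
multiplies the whole second-order cold-start correction by exactly `r^b`. [ours] -/
theorem imh_chain_windowMSE_mode_sub_stationary [Fact (Measurable w)] (hw0 : ∀ y, 0 < w y) {x₀ : Ω}
    (hmax : ∀ y, w y ≤ w x₀) [IsProbabilityMeasure (q.withDensity fun y => ENNReal.ofReal (w y))]
    {f : Ω → ℝ} (hf : Measurable f) {C : ℝ} (hC : ∀ x, |f x| ≤ C) (b : ℕ) {N : ℕ} (hN : N ≠ 0) :
    (N : ℝ) ^ 2 *
        (∫ x, ((∑ i ∈ Finset.range N, f (x (b + i))) / N -
              ∫ z, f z ∂(q.withDensity fun y => ENNReal.ofReal (w y))) ^ 2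
            ∂(Kernel.trajMeasure (X := fun _ : ℕ => Ω) (Measure.dirac x₀)
              (fun n : ℕ => (indepMH q w).comap (fun h : (i : ↥(Finset.Iic n)) → Ω => h ⟨n, Finset.mem_Iic.2 le_rfl⟩)
                (measurable_pi_apply _))) -
          ∫ x, ((∑ i ∈ Finset.range N, f (x i)) / N - ∫ z, f z ∂(q.withDensity fun y => ENNReal.ofReal (w y))) ^ 2
            ∂(Kernel.trajMeasure (X := fun _ : ℕ => Ω) (q.withDensity fun y => ENNReal.ofReal (w y))
              (fun n : ℕ => (indepMH q w).comap (fun h : (i : ↥(Finset.Iic n)) → Ω => h ⟨n, Finset.mem_Iic.2 le_rfl⟩)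
                (measurable_pi_apply _)))) =
      (1 - (w x₀)⁻¹) ^ b *
        ((f x₀ - ∫ z, f z ∂(q.withDensity fun y => ENNReal.ofReal (w y))) ^ 2 *
            ∑ k ∈ Finset.range N, (2 * (k : ℝ) + 1) * (1 - (w x₀)⁻¹) ^ k -
          ∑ i ∈ Finset.range N, ∑ j ∈ Finset.range N, (1 - (w x₀)⁻¹) ^ min i j *
            autocov (indepMH q w) (q.withDensity fun y => ENNReal.ofReal (w y))
              (fun x => f x - ∫ z, f z ∂(q.withDensity fun y => ENNReal.ofReal (w y))) (Nat.dist i j)) := by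
  have hNpos : (0 : ℝ) < N := by exact_mod_cast Nat.pos_of_ne_zero hN
  have hN2 : (N : ℝ) ^ 2 ≠ 0 := pow_ne_zero 2 hNpos.ne'
  have hπ : Kernel.Invariant (indepMH q w) (q.withDensity fun y => ENNReal.ofReal (w y)) :=
    indepMH_invariant (q := q) Fact.out hw0
  rw [chain_sqError_windowAverage_eq (indepMH q w) (Measure.dirac x₀) hf hC _ b hN,
    chain_mse_stationary_eq (indepMH q w) hπ hf hC hN]
  simp only [imh_chain_window_pair_mode hw0 hmax hf hC b]
  rw [sum_sum_window_split, ← sub_div, mul_div_cancel₀ _ hN2]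
  ring

/-! ## §4 Two-sided, and the discard recipe -/

/-- **TWO-SIDED WINDOW LAW**: `r^b·(δ² − V)·P_N ≤ N²·(E_{x₀}[(A_{b,N} − π f)²] − MSE_π(N)) ≤ r^b·δ²·P_N` (`N ≥ 1`).
[ours] -/
theorem imh_chain_windowMSE_mode_two_sided [Fact (Measurable w)] (hw0 : ∀ y, 0 < w y) {x₀ : Ω}
    (hmax : ∀ y, w y ≤ w x₀) [IsProbabilityMeasure (q.withDensity fun y => ENNReal.ofReal (w y))]
    {f : Ω → ℝ} (hf : Measurable f) {C : ℝ} (hC : ∀ x, |f x| ≤ C) (b : ℕ) {N : ℕ} (hN : N ≠ 0) :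
    (1 - (w x₀)⁻¹) ^ b * (((f x₀ - ∫ z, f z ∂(q.withDensity fun y => ENNReal.ofReal (w y))) ^ 2 -
          ∫ x, (f x - ∫ z, f z ∂(q.withDensity fun y => ENNReal.ofReal (w y))) ^ 2
            ∂(q.withDensity fun y => ENNReal.ofReal (w y))) *
        ∑ k ∈ Finset.range N, (2 * (k : ℝ) + 1) * (1 - (w x₀)⁻¹) ^ k) ≤
      (N : ℝ) ^ 2 *
        (∫ x, ((∑ i ∈ Finset.range N, f (x (b + i))) / N -
              ∫ z, f z ∂(q.withDensity fun y => ENNReal.ofReal (w y))) ^ 2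
            ∂(Kernel.trajMeasure (X := fun _ : ℕ => Ω) (Measure.dirac x₀)
              (fun n : ℕ => (indepMH q w).comap (fun h : (i : ↥(Finset.Iic n)) → Ω => h ⟨n, Finset.mem_Iic.2 le_rfl⟩)
                (measurable_pi_apply _))) -
          ∫ x, ((∑ i ∈ Finset.range N, f (x i)) / N - ∫ z, f z ∂(q.withDensity fun y => ENNReal.ofReal (w y))) ^ 2
            ∂(Kernel.trajMeasure (X := fun _ : ℕ => Ω) (q.withDensity fun y => ENNReal.ofReal (w y))
              (fun n : ℕ => (indepMH q w).comap (fun h : (i : ↥(Finset.Iic n)) → Ω => h ⟨n, Finset.mem_Iic.2 le_rfl⟩)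
                (measurable_pi_apply _)))) ∧
    (N : ℝ) ^ 2 *
        (∫ x, ((∑ i ∈ Finset.range N, f (x (b + i))) / N -
              ∫ z, f z ∂(q.withDensity fun y => ENNReal.ofReal (w y))) ^ 2
            ∂(Kernel.trajMeasure (X := fun _ : ℕ => Ω) (Measure.dirac x₀)
              (fun n : ℕ => (indepMH q w).comap (fun h : (i : ↥(Finset.Iic n)) → Ω => h ⟨n, Finset.mem_Iic.2 le_rfl⟩)
                (measurable_pi_apply _))) -
          ∫ x, ((∑ i ∈ Finset.range N, f (x i)) / N - ∫ z, f z ∂(q.withDensity fun y => ENNReal.ofReal (w y))) ^ 2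
            ∂(Kernel.trajMeasure (X := fun _ : ℕ => Ω) (q.withDensity fun y => ENNReal.ofReal (w y))
              (fun n : ℕ => (indepMH q w).comap (fun h : (i : ↥(Finset.Iic n)) → Ω => h ⟨n, Finset.mem_Iic.2 le_rfl⟩)
                (measurable_pi_apply _)))) ≤
      (1 - (w x₀)⁻¹) ^ b * ((f x₀ - ∫ z, f z ∂(q.withDensity fun y => ENNReal.ofReal (w y))) ^ 2 *
        ∑ k ∈ Finset.range N, (2 * (k : ℝ) + 1) * (1 - (w x₀)⁻¹) ^ k) := by
  have hW : 1 ≤ w x₀ := one_le_of_mode (q := q) hmax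
  have hr0 : 0 ≤ 1 - (w x₀)⁻¹ := sub_nonneg.2 (inv_le_one_of_one_le₀ hW)
  have hrb : 0 ≤ (1 - (w x₀)⁻¹) ^ b := pow_nonneg hr0 b
  obtain ⟨h0, h1⟩ := imh_sum_sum_pow_min_autocov_bounds (q := q) Fact.out hw0 hmax hf hC N (x₀ := x₀)
  rw [imh_chain_windowMSE_mode_sub_stationary hw0 hmax hf hC b hN]
  constructor
  · rw [sub_mul, mul_sub]
    nlinarith [mul_le_mul_of_nonneg_left h1 hrb]
  · nlinarith [mul_nonneg hrb h0]

/-- **`E_{x₀}[(A_{b,N} − π f)²] ≤ MSE_π(N) + r^b·(2w(x₀)² − w(x₀))·δ²/N²`** (`N ≥ 1`). [ours] -/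
theorem imh_chain_windowMSE_mode_le [Fact (Measurable w)] (hw0 : ∀ y, 0 < w y) {x₀ : Ω}
    (hmax : ∀ y, w y ≤ w x₀) [IsProbabilityMeasure (q.withDensity fun y => ENNReal.ofReal (w y))]
    {f : Ω → ℝ} (hf : Measurable f) {C : ℝ} (hC : ∀ x, |f x| ≤ C) (b : ℕ) {N : ℕ} (hN : N ≠ 0) :
    ∫ x, ((∑ i ∈ Finset.range N, f (x (b + i))) / N -
          ∫ z, f z ∂(q.withDensity fun y => ENNReal.ofReal (w y))) ^ 2
        ∂(Kernel.trajMeasure (X := fun _ : ℕ => Ω) (Measure.dirac x₀)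
          (fun n : ℕ => (indepMH q w).comap (fun h : (i : ↥(Finset.Iic n)) → Ω => h ⟨n, Finset.mem_Iic.2 le_rfl⟩)
            (measurable_pi_apply _))) ≤
      ∫ x, ((∑ i ∈ Finset.range N, f (x i)) / N - ∫ z, f z ∂(q.withDensity fun y => ENNReal.ofReal (w y))) ^ 2
          ∂(Kernel.trajMeasure (X := fun _ : ℕ => Ω) (q.withDensity fun y => ENNReal.ofReal (w y))
            (fun n : ℕ => (indepMH q w).comap (fun h : (i : ↥(Finset.Iic n)) → Ω => h ⟨n, Finset.mem_Iic.2 le_rfl⟩)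
              (measurable_pi_apply _))) +
        (1 - (w x₀)⁻¹) ^ b * (2 * w x₀ ^ 2 - w x₀) *
          (f x₀ - ∫ z, f z ∂(q.withDensity fun y => ENNReal.ofReal (w y))) ^ 2 / (N : ℝ) ^ 2 := by
  set MSEb := ∫ x, ((∑ i ∈ Finset.range N, f (x (b + i))) / N -
          ∫ z, f z ∂(q.withDensity fun y => ENNReal.ofReal (w y))) ^ 2
        ∂(Kernel.trajMeasure (X := fun _ : ℕ => Ω) (Measure.dirac x₀)
          (fun n : ℕ => (indepMH q w).comap (fun h : (i : ↥(Finset.Iic n)) → Ω => h ⟨n, Finset.mem_Iic.2 le_rfl⟩)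
            (measurable_pi_apply _))) with hMSEb
  set MSEπ := ∫ x, ((∑ i ∈ Finset.range N, f (x i)) / N - ∫ z, f z ∂(q.withDensity fun y => ENNReal.ofReal (w y))) ^ 2
          ∂(Kernel.trajMeasure (X := fun _ : ℕ => Ω) (q.withDensity fun y => ENNReal.ofReal (w y))
            (fun n : ℕ => (indepMH q w).comap (fun h : (i : ↥(Finset.Iic n)) → Ω => h ⟨n, Finset.mem_Iic.2 le_rfl⟩)
              (measurable_pi_apply _))) with hMSEπ
  set δ := f x₀ - ∫ z, f z ∂(q.withDensity fun y => ENNReal.ofReal (w y)) with hδdef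
  have hNpos : (0 : ℝ) < N := by exact_mod_cast Nat.pos_of_ne_zero hN
  have hN2 : (0 : ℝ) < (N : ℝ) ^ 2 := pow_pos hNpos 2
  have hW : 1 ≤ w x₀ := one_le_of_mode (q := q) hmax
  have hr0 : 0 ≤ 1 - (w x₀)⁻¹ := sub_nonneg.2 (inv_le_one_of_one_le₀ hW)
  have hrb : 0 ≤ (1 - (w x₀)⁻¹) ^ b := pow_nonneg hr0 b
  obtain ⟨-, h1⟩ := imh_chain_windowMSE_mode_two_sided (q := q) hw0 hmax hf hC b hN (x₀ := x₀)
  have hP := oddPowSum_le_mode (q := q) hw0 hmax N (x₀ := x₀)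
  have hδ : 0 ≤ δ ^ 2 := sq_nonneg _
  have h2 := mul_le_mul_of_nonneg_left (mul_le_mul_of_nonneg_left hP hδ) hrb
  have h3 : MSEb - MSEπ ≤ (1 - (w x₀)⁻¹) ^ b * (2 * w x₀ ^ 2 - w x₀) * δ ^ 2 / (N : ℝ) ^ 2 := by
    rw [le_div_iff₀ hN2]
    nlinarith [h1, h2]
  linarith

/-- **THE DISCARD RECIPE AT SECOND ORDER**: `log(1/ε) ≤ b/w(x₀)` (`0 < ε`) ⇒
`E_{x₀}[(A_{b,N} − π f)²] ≤ MSE_π(N) + ε·(2w(x₀)² − w(x₀))·δ²/N²`. [ours] -/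
theorem imh_chain_windowMSE_mode_le_of_log_le [Fact (Measurable w)] (hw0 : ∀ y, 0 < w y) {x₀ : Ω}
    (hmax : ∀ y, w y ≤ w x₀) [IsProbabilityMeasure (q.withDensity fun y => ENNReal.ofReal (w y))]
    {f : Ω → ℝ} (hf : Measurable f) {C : ℝ} (hC : ∀ x, |f x| ≤ C) {b : ℕ} {ε : ℝ} (hε : 0 < ε)
    (hb : Real.log (1 / ε) ≤ b * (w x₀)⁻¹) {N : ℕ} (hN : N ≠ 0) :
    ∫ x, ((∑ i ∈ Finset.range N, f (x (b + i))) / N -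
          ∫ z, f z ∂(q.withDensity fun y => ENNReal.ofReal (w y))) ^ 2
        ∂(Kernel.trajMeasure (X := fun _ : ℕ => Ω) (Measure.dirac x₀)
          (fun n : ℕ => (indepMH q w).comap (fun h : (i : ↥(Finset.Iic n)) → Ω => h ⟨n, Finset.mem_Iic.2 le_rfl⟩)
            (measurable_pi_apply _))) ≤
      ∫ x, ((∑ i ∈ Finset.range N, f (x i)) / N - ∫ z, f z ∂(q.withDensity fun y => ENNReal.ofReal (w y))) ^ 2
          ∂(Kernel.trajMeasure (X := fun _ : ℕ => Ω) (q.withDensity fun y => ENNReal.ofReal (w y))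
            (fun n : ℕ => (indepMH q w).comap (fun h : (i : ↥(Finset.Iic n)) → Ω => h ⟨n, Finset.mem_Iic.2 le_rfl⟩)
              (measurable_pi_apply _))) +
        ε * (2 * w x₀ ^ 2 - w x₀) *
          (f x₀ - ∫ z, f z ∂(q.withDensity fun y => ENNReal.ofReal (w y))) ^ 2 / (N : ℝ) ^ 2 := by
  have hNpos : (0 : ℝ) < N := by exact_mod_cast Nat.pos_of_ne_zero hN
  have hN2 : (0 : ℝ) < (N : ℝ) ^ 2 := pow_pos hNpos 2
  have hW : 1 ≤ w x₀ := one_le_of_mode (q := q) hmax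
  have hrb := pow_mode_le_of_log_le (q := q) hmax hε hb (x₀ := x₀)
  have hc : 0 ≤ (2 * w x₀ ^ 2 - w x₀) *
      (f x₀ - ∫ z, f z ∂(q.withDensity fun y => ENNReal.ofReal (w y))) ^ 2 / (N : ℝ) ^ 2 := by
    refine div_nonneg (mul_nonneg ?_ (sq_nonneg _)) hN2.le
    nlinarith
  have h := imh_chain_windowMSE_mode_le (q := q) hw0 hmax hf hC b hN (x₀ := x₀)
  have h2 := mul_le_mul_of_nonneg_right hrb hc
  have key : (1 - (w x₀)⁻¹) ^ b * (2 * w x₀ ^ 2 - w x₀) *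
        (f x₀ - ∫ z, f z ∂(q.withDensity fun y => ENNReal.ofReal (w y))) ^ 2 / (N : ℝ) ^ 2 ≤
      ε * (2 * w x₀ ^ 2 - w x₀) *
        (f x₀ - ∫ z, f z ∂(q.withDensity fun y => ENNReal.ofReal (w y))) ^ 2 / (N : ℝ) ^ 2 := by
    calc (1 - (w x₀)⁻¹) ^ b * (2 * w x₀ ^ 2 - w x₀) *
          (f x₀ - ∫ z, f z ∂(q.withDensity fun y => ENNReal.ofReal (w y))) ^ 2 / (N : ℝ) ^ 2
        = (1 - (w x₀)⁻¹) ^ b * ((2 * w x₀ ^ 2 - w x₀) *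
          (f x₀ - ∫ z, f z ∂(q.withDensity fun y => ENNReal.ofReal (w y))) ^ 2 / (N : ℝ) ^ 2) := by ring
      _ ≤ ε * ((2 * w x₀ ^ 2 - w x₀) *
          (f x₀ - ∫ z, f z ∂(q.withDensity fun y => ENNReal.ofReal (w y))) ^ 2 / (N : ℝ) ^ 2) := h2
      _ = _ := by ring
  linarith [h, key]

/-! ## §5 The window's sharp constant -/

/-- **`N²·(E_{x₀}[(A_{b,N} − π f)²] − MSE_π(N)) → r^b·((2w² − w)δ² − w·σ²_f)`.** [ours] -/
theorem imh_chain_windowMSE_mode_limit [Fact (Measurable w)] (hw0 : ∀ y, 0 < w y) {x₀ : Ω}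
    (hmax : ∀ y, w y ≤ w x₀) [IsProbabilityMeasure (q.withDensity fun y => ENNReal.ofReal (w y))]
    {f : Ω → ℝ} (hf : Measurable f) {C : ℝ} (hC : ∀ x, |f x| ≤ C) (b : ℕ) :
    Tendsto (fun N : ℕ => (N : ℝ) ^ 2 *
        (∫ x, ((∑ i ∈ Finset.range N, f (x (b + i))) / N -
              ∫ z, f z ∂(q.withDensity fun y => ENNReal.ofReal (w y))) ^ 2
            ∂(Kernel.trajMeasure (X := fun _ : ℕ => Ω) (Measure.dirac x₀)
              (fun n : ℕ => (indepMH q w).comap (fun h : (i : ↥(Finset.Iic n)) → Ω => h ⟨n, Finset.mem_Iic.2 le_rfl⟩)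
                (measurable_pi_apply _))) -
          ∫ x, ((∑ i ∈ Finset.range N, f (x i)) / N - ∫ z, f z ∂(q.withDensity fun y => ENNReal.ofReal (w y))) ^ 2
            ∂(Kernel.trajMeasure (X := fun _ : ℕ => Ω) (q.withDensity fun y => ENNReal.ofReal (w y))
              (fun n : ℕ => (indepMH q w).comap (fun h : (i : ↥(Finset.Iic n)) → Ω => h ⟨n, Finset.mem_Iic.2 le_rfl⟩)
                (measurable_pi_apply _)))))
      atTop
      (𝓝 ((1 - (w x₀)⁻¹) ^ b *
        ((2 * w x₀ ^ 2 - w x₀) * (f x₀ - ∫ z, f z ∂(q.withDensity fun y => ENNReal.ofReal (w y))) ^ 2 -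
          w x₀ * (autocov (indepMH q w) (q.withDensity fun y => ENNReal.ofReal (w y))
              (fun x => f x - ∫ z, f z ∂(q.withDensity fun y => ENNReal.ofReal (w y))) 0 +
            2 * ∑' u, autocov (indepMH q w) (q.withDensity fun y => ENNReal.ofReal (w y))
              (fun x => f x - ∫ z, f z ∂(q.withDensity fun y => ENNReal.ofReal (w y))) (u + 1))))) := by
  have hlim := (imh_chain_mse_mode_limit (q := q) hw0 hmax hf hC (x₀ := x₀)).const_mul ((1 - (w x₀)⁻¹) ^ b)
  refine hlim.congr' ?_
  filter_upwards [eventually_ne_atTop 0] with N hN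
  rw [imh_chain_windowMSE_mode_sub_stationary hw0 hmax hf hC b hN, imh_chain_mse_mode_sub_stationary hw0 hmax hf hC hN]

end Summit.Ventures.LatticeQCDFlow.Exactness
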